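import Summits.Langlands.Langlands.Theorems.PhantomRMYoshidaResiduallyYoshidaLiftingCrossRegularDefs
import HarnessLib

/-!
# `ResiduallyYoshidaLifting` (stmt-Langlands-13639, route PhantomRMYoshida), line `cross-regular-annihilator-primes`:
# NEGATIVE LEMMA for the coverage stub S1 `stub_exactCrossElement` — it fails at every admissible `p = 3`
# Frobenius-twist datum

S1 (`stub_exactCrossElement`, registered sub-goal of the crux item) asks, from the crux hypotheses alone, for an
EXACT cross-regular element of `im ρ` (`ExactCross σ σ' red ρ` of the Theorems-side currency
`…CrossRegularAnnihilatorPrimes`): `charpoly ρ(γ) = (X−a)(X−ea)(X−b)(X−eb)`, `e = ε_p(γ)`, `e²ab = 1`, in cross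
position residually and residually GENERIC (`Gen (red e) (red a) (red b)`).

The obstruction (standing crux disprover, `Cruxes/ResiduallyYoshidaLifting/Disproof.lean`, cdisprove gen 3, T6a,
there proved about the disprover's byte-identical copy `CR.ExactCross`; re-homed here over OUR currency so that it
is importable and registered): at `p = 3`, whenever `charpoly σ̄'(γ) = Frob(charpoly σ̄(γ))` for all `γ` (the
"phantom-RM" pairs `σ̄' = σ̄^(3)`, the route's own source of residual data), `ExactCross σ σ' red ρ` is
UNSATISFIABLE for every `ρ` and every `red`: `red e ∈ 𝔽₃` (any ring map `ℤ̄₃ → k` sends `ℤ₃` into the prime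
field), genericity forces `red e = −1`, and then comparing roots of `(X − ēā)(X − b̄) = (X − ā³)(X − ē³b̄³)` with
`ā b̄ = 1` gives `ā⁴ = 1` or `b̄⁴ = 1`, against genericity.  Hence the registered S1 is refuted by ANY admissible
Frobenius-twisted datum at `p = 3` carrying an irreducible `Sh`-lift `ρ` (`stub_exactCrossElement_false_of_frobTwistThree`,
the registered negative sub-goal; such data exist in nature — abelian surfaces with `3`-torsion of `GL₂(𝔽₉)`-type —
but none is constructible in the tree, whence no formal `¬ S1`).

Contents: `gen_frobTwist_char3_false` (the algebraic core in a field of characteristic `3`),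
`ringHom_padicInt_pow_char` (a ring map `ℤ_p → k` into characteristic `p` has Frobenius-fixed values),
`exists_ringHom_padicInt_integer` (the inclusion `ℤ_p → ℤ̄_p` exists as a ring map; an `∃`-statement, no `def`),
`not_exactCross_of_frobTwist_three` (interface form), `stub_exactCrossElement_false_of_frobTwistThree` (registered).

References: J. Thorne, *Automorphy of some residually dihedral Galois representations*, Math. Ann. 364 (2016)
[Thorne2016, §5.4.4, Prop. 5.20].  All statements below are elementary algebra. [folklore]
-/

noncomputable section

-- `Summit.Langlands.Langlands.…` (summit = sub-problem name, D-0017 layout) trips `dupNamespace` on every decl.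
set_option linter.dupNamespace false
set_option autoImplicit false

open scoped Matrix Classical

namespace Summit.Langlands.Langlands.Cruxes.ResiduallyYoshidaLifting.CrossRegularAnnihilatorPrimes

/-- **Algebraic core.**  In a field of characteristic `3` there are no `e, a, b` with `e³ = e`, `e²ab = 1`,
`Gen e a b` and `(X − ea)(X − b) = Frob((X − a)(X − eb))`: `e ≠ 0, 1` forces `e = −1`, so `ab = 1`, and
evaluating the quadratic identity at `−a` and at `b` gives `a⁴ = 1` or `b⁴ = 1`, i.e. `a = ±b`, excluded by
genericity. [folklore] -/
-- adapted from Cruxes/ResiduallyYoshidaLifting/Disproof.lean (cdisprove gen 3), CR.no_exactCross_frobTwist_char3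
theorem gen_frobTwist_char3_false {k : Type} [Field k] [CharP k 3] {e a b : k}
    (he : e ^ 3 = e) (hab : e ^ 2 * a * b = 1) (hgen : Gen e a b)
    (hcross : (Polynomial.X - Polynomial.C (e * a)) * (Polynomial.X - Polynomial.C b) =
      ((Polynomial.X - Polynomial.C a) * (Polynomial.X - Polynomial.C (e * b))).map (frobenius k 3)) :
    False := by
  obtain ⟨h1, h2, h3, h4, -, -, -, -⟩ := hgen
  have ha : a ≠ 0 := by
    rintro rfl
    exact h1 (by ring)
  have he0 : e ≠ 0 := by
    rintro rfl
    simp at hab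
  have he1 : e ≠ 1 := by
    rintro rfl
    exact h1 (by ring)
  -- `e³ = e`, `e ≠ 0, 1` ⇒ `e = -1`
  have he' : e = -1 := by
    have h0 : e * (e - 1) * (e + 1) = 0 := by linear_combination he
    rcases mul_eq_zero.mp h0 with h | h
    · rcases mul_eq_zero.mp h with h | h
      · exact absurd h he0
      · exact absurd (sub_eq_zero.mp h) he1
    · linear_combination h
  subst he'
  have hab' : a * b = 1 := by linear_combination hab
  -- the Frobenius-twisted quadratic, explicitly
  simp only [Polynomial.map_mul, Polynomial.map_sub, Polynomial.map_X, Polynomial.map_C,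
    frobenius_def] at hcross
  have hev1 := congrArg (Polynomial.eval (-1 * a)) hcross
  have hev2 := congrArg (Polynomial.eval b) hcross
  simp only [Polynomial.eval_mul, Polynomial.eval_sub, Polynomial.eval_X, Polynomial.eval_C,
    sub_self, zero_mul, mul_zero] at hev1 hev2
  have hA : a ^ 3 = -a ∨ a = b ^ 3 := by
    rcases mul_eq_zero.mp hev1.symm with h | h
    · left; linear_combination -h
    · right; linear_combination -h
  have hB : b = a ^ 3 ∨ b ^ 3 = -b := by
    rcases mul_eq_zero.mp hev2.symm with h | h
    · left; linear_combination h
    · right; linear_combination h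
  rcases hA with hA | hA <;> rcases hB with hB | hB
  · -- `a³ = -a`, `b = a³` ⇒ `b = -a`
    exact h4 (by linear_combination -hA - hB)
  · -- `a³ = -a` (so `a² = -1`), `b³ = -b`; with `ab = 1`: `b = -a`
    have ha2 : a ^ 2 = -1 := by
      apply mul_left_cancel₀ ha
      linear_combination hA
    exact h4 (by
      apply mul_left_cancel₀ ha
      linear_combination -hab' - ha2)
  · -- `a = b³`, `b = a³` ⇒ `b⁴ = ab = 1` ⇒ `b² = ±1` ⇒ `a = b` or `a = -b`
    have hb4 : b ^ 4 = 1 := by linear_combination -b * hA + hab'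
    have hsq : (b ^ 2 - 1) * (b ^ 2 + 1) = 0 := by linear_combination hb4
    rcases mul_eq_zero.mp hsq with h | h
    · exact h2 (by linear_combination hA + b * h)
    · exact h3 (by linear_combination hA + b * h)
  · -- `a = b³`, `b³ = -b` ⇒ `a = -b`
    exact h3 (by linear_combination hA + hB)

/-- Any ring map `ℤ_p → k` into a ring of characteristic `p` takes Frobenius-fixed values: writing
`u = n + p·w` with `n = zmodRepr u ∈ ℕ` (`PadicInt.sub_zmodRepr_mem`), `f u = n` and `n^p = n` (Fermat, as
`map_natCast (frobenius k p)`).  So its image is the prime field. [folklore] -/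
-- adapted from Cruxes/ResiduallyYoshidaLifting/Disproof.lean (cdisprove gen 3), CR.frobenius_apply_padicInt
theorem ringHom_padicInt_pow_char {p : ℕ} [Fact p.Prime] {k : Type} [CommRing k] [CharP k p]
    (f : ℤ_[p] →+* k) (u : ℤ_[p]) : f u ^ p = f u := by
  have hmem : u - (u.zmodRepr : ℤ_[p]) ∈ Ideal.span {(p : ℤ_[p])} := by
    rw [← PadicInt.maximalIdeal_eq_span_p]; exact PadicInt.sub_zmodRepr_mem u
  obtain ⟨w, hw⟩ := Ideal.mem_span_singleton'.mp hmem
  have hu : u = (u.zmodRepr : ℤ_[p]) + w * p := by linear_combination -hw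
  have hfu : f u = (u.zmodRepr : k) := by
    have h := congrArg f hu
    rwa [map_add, map_natCast, map_mul, map_natCast, CharP.cast_eq_zero k p, mul_zero, add_zero] at h
  rw [hfu]
  have h := map_natCast (frobenius k p) u.zmodRepr
  rwa [frobenius_def] at h

/-- The inclusion `ℤ_p ⊆ ℤ̄_p = 𝒪[ℚ̄_p]` is a ring map (the restriction of `ℚ_p → ℚ̄_p`, integral-valued
since `‖u‖ ≤ 1` and the norm on `ℚ̄_p` extends the `p`-adic norm); stated as an existence so that this file
declares no `def`. [folklore] -/
theorem exists_ringHom_padicInt_integer (p : ℕ) [Fact p.Prime] :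
    ∃ f : ℤ_[p] →+* Valued.integer (PadicAlgCl p),
      ∀ u : ℤ_[p], ((f u : Valued.integer (PadicAlgCl p)) : PadicAlgCl p) =
        algebraMap ℚ_[p] (PadicAlgCl p) (u : ℚ_[p]) := by
  refine ⟨RingHom.codRestrict ((algebraMap ℚ_[p] (PadicAlgCl p)).comp PadicInt.Coe.ringHom)
    (Valued.v (R := PadicAlgCl p)).integer fun u => ?_, fun u => rfl⟩
  rw [Valuation.mem_integer_iff, PadicAlgCl.valuation_def, ← NNReal.coe_le_coe, coe_nnnorm]
  change ‖((u : ℚ_[p]) : PadicAlgCl p)‖ ≤ 1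
  rw [PadicAlgCl.norm_extends]
  exact PadicInt.norm_le_one u

/-- **`ExactCross` is UNSATISFIABLE on the `p = 3` Frobenius-twist sub-sector** (interface form of T6a over the
Theorems-side currency).  If `charpoly σ̄'(γ) = Frob(charpoly σ̄(γ))` for every `γ` (e.g. `σ̄' = σ̄^(3)`, the
phantom-RM pairs of the route's own source), then `ExactCross σ σ' red ρ` fails for EVERY
`ρ : Γ_ℚ → GL₄(ℚ̄₃)` and every `red : ℤ̄₃ → k`, `k` of characteristic `3`: `red (ε₃(γ)) ∈ 𝔽₃`
(`ringHom_padicInt_pow_char` through `exists_ringHom_padicInt_integer`), and the rest is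
`gen_frobTwist_char3_false`. [folklore] -/
-- adapted from Cruxes/ResiduallyYoshidaLifting/Disproof.lean (cdisprove gen 3), CR.not_exactCross_of_frobTwist_three
theorem not_exactCross_of_frobTwist_three {k : Type} [Field k] [CharP k 3] [TopologicalSpace k]
    (red : Valued.integer (PadicAlgCl 3) →+* k)
    (σ σ' : Literature.NumberTheory.GaloisRepresentations.FramedGaloisRep ℚ k 2)
    (ρ : Literature.NumberTheory.GaloisRepresentations.FramedGaloisRep ℚ (PadicAlgCl 3) 4)
    (hFrob : ∀ γ, (σ' γ).val.charpoly = ((σ γ).val.charpoly).map (frobenius k 3)) :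
    ¬ ExactCross σ σ' red ρ := by
  rintro ⟨γ, a, b, e, he, hab, -, hσ, hσ', hgen⟩
  obtain ⟨f, hf⟩ := exists_ringHom_padicInt_integer 3
  have he' : e = f ((Literature.NumberTheory.GaloisRepresentations.GaloisRep.cyclotomicCharacter ℚ 3 γ :
      ℤ_[3]ˣ) : ℤ_[3]) :=
    Subtype.ext (he.trans (hf _).symm)
  have hred3 : red e ^ 3 = red e := by
    rw [he', ← RingHom.comp_apply]
    exact ringHom_padicInt_pow_char (red.comp f) _
  have hab' : red e ^ 2 * red a * red b = 1 := by
    simpa using congrArg red hab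
  refine gen_frobTwist_char3_false hred3 hab' hgen ?_
  rw [← hσ', hFrob γ, hσ]

/-- **NEGATIVE SUB-GOAL for S1 (`stub_exactCrossElement`, line `cross-regular-annihilator-primes`).**  One
admissible Frobenius-twisted datum at `p = 3` refutes S1: given `k` of characteristic `3`, `red : ℤ̄₃ → k`,
a residual pair `σ̄, σ̄'` with `charpoly σ̄'(γ) = Frob(charpoly σ̄(γ))` for all `γ` satisfying the crux's residual
hypotheses (irreducible, `DetCond`, non-conjugate), and an irreducible `ρ : Γ_ℚ → GL₄(ℚ̄₃)` of shape `Sh`, the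
registered S1 statement (verbatim, parenthesised) is FALSE — its conclusion `ExactCross σ σ' red ρ` at this datum
contradicts `not_exactCross_of_frobTwist_three`.  (Disproof T6a re-homed over the Theorems-side currency; S1 at
`p = 3` on Frobenius-twisted pairs is equivalent to the vacuity of its own hypotheses.) [folklore] -/
theorem stub_exactCrossElement_false_of_frobTwistThree :
    ∀ (k : Type) [Field k] [CharP k 3] [IsAlgClosed k] [TopologicalSpace k] [DiscreteTopology k] (red : Valued.integer (PadicAlgCl 3) →+* k) (σ σ' : Literature.NumberTheory.GaloisRepresentations.FramedGaloisRep ℚ k 2) (hcpt : Literature.NumberTheory.Automorphic.isCompact_glFiniteIntegralLevel 4 ℚ) (ι : PadicAlgCl 3 ≃+* ℂ) (ρ : Literature.NumberTheory.GaloisRepresentations.FramedGaloisRep ℚ (PadicAlgCl 3) 4), (∀ γ, (σ' γ).val.charpoly = ((σ γ).val.charpoly).map (frobenius k 3)) → σ.toGaloisRep.IsIrreducible → σ'.toGaloisRep.IsIrreducible → Summit.Langlands.Langlands.Cruxes.ResiduallyYoshidaLifting.CrossRegularAnnihilatorPrimes.DetCond 3 σ σ' → (¬ ∃ g : GL (Fin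 2) k, ∀ x, g * σ x * g⁻¹ = σ' x) → ρ.toGaloisRep.IsIrreducible → Summit.Langlands.Langlands.Cruxes.ResiduallyYoshidaLifting.CrossRegularAnnihilatorPrimes.Sh σ σ' red ρ → ¬ (∀ (p : ℕ) [Fact p.Prime], p ≠ 2 → ∀ (k : Type) [Field k] [CharP k p] [IsAlgClosed k] [TopologicalSpace k] [DiscreteTopology k] (red : Valued.integer (PadicAlgCl p) →+* k) (σ σ' : Literature.NumberTheory.GaloisRepresentations.FramedGaloisRep ℚ k 2) (hcpt : Literature.NumberTheory.Automorphic.isCompact_glFiniteIntegralLevel 4 ℚ) (ι : PadicAlgCl p ≃+* ℂ) (ρ : Literature.NumberTheory.GaloisRepresentations.FramedGaloisRep ℚ (PadicAlgCl p) 4), σ.toGaloisRep.IsIrreducible → σ'.toGaloisRep.IsIrreducible → Summit.Langlands.Langlands.Cruxes.ResiduallyYoshidaLifting.CrossRegularAnnihilatorPrimes.DetCond p σ σ' → (¬ ∃ g : GL (Fin 2) k, ∀ x, g * σ x * g⁻¹ = σ' x) → ρ.toGaloisRep.IsIrreducible → Summit.Langlands.Langlands.Cruxes.ResiduallyYoshidaLifting.CrossRegularAnnihilatorPrimes.Sh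 σ σ' red ρ → Summit.Langlands.Langlands.Cruxes.ResiduallyYoshidaLifting.CrossRegularAnnihilatorPrimes.ExactCross σ σ' red ρ) := by
  intro k _ _ _ _ _ red σ σ' hcpt ι ρ hFrob hirr hirr' hdet hnc hρ hSh h1
  exact not_exactCross_of_frobTwist_three red σ σ' ρ hFrob
    (h1 3 (by decide) k red σ σ' hcpt ι ρ hirr hirr' hdet hnc hρ hSh)

end Summit.Langlands.Langlands.Cruxes.ResiduallyYoshidaLifting.CrossRegularAnnihilatorPrimes

end
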